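import Summits.QuantumFields.QCD.Theses.HeatSlicedQuarks
import Summits.QuantumFields.QCD.Theorems.HeatSlicedQuarksSmallFieldUltracontractivityFixedPointC
import Summits.QuantumFields.QCD.Theorems.HeatSlicedQuarksSmallFieldUltracontractivityFixedPointA
import Mathlib.Analysis.SpecialFunctions.Integrals.Basic

/-!
# Helpers (B) for stub `stub_columnIdentification` of line `Sketch` (crux `InterleavedHeatSliceFlow`, item stmt-QuantumFields-8891)

Bookkeeping lemmas for the column Duhamel of `stub_columnIdentification`:

* `sum_weight_norm_sq_le_of_profile`, `sum_weight_norm_le_of_profile` — a colour–spin-blind entry profile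
  `‖g(z,b,β)‖ ≤ C φ(z)` turns weighted sums over `TorusSite 4 L × Fin 3 × Fin 4` into `12 C² Σ_z w φ²`,
  `12 C Σ_z w φ`;
* `integral_inv_sqrt_one_add_mul_le` — `∫₀ᵇ du/√(1 + k u) ≤ 2√(1 + k b)/k` (`k > 0`, `b ≥ 0`), the time integral of
  the merged smoothing profile;
* `late_smoothing_const_le`, `early_smoothing_const_le` — the two elementary constant estimates that make the
  early and late Duhamel integrals `s`-uniform;
* `column_norm_le_of_pointwise` — the Minkowski bookkeeping: from the two pointwise bounds of the Duhamel integrand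
  (merged smoothing profile + contraction, resp. + ultracontractivity on the early half) to the `s`-uniform bound
  `‖v‖₂ ≤ 40 P + Q` of the column.

Elementary real analysis; no named facts.
-/

noncomputable section

namespace Summit.QuantumFields.QCD.Cruxes.InterleavedHeatSliceFlow.Sketch

open Literature.MathematicalPhysics.QuantumLattice Literature.MathematicalPhysics.QuantumFieldTheory
  Literature.Probability.LatticeModels
open Summit.QuantumFields.QCD.Theses.HeatSlicedQuarks
open MeasureTheory intervalIntegral
open scoped Matrix

section Weighted

variable {L : ℕ} [NeZero L]

/-- Sums over the quark index type split into site and colour–spin sums. -/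
theorem sum_site_colour_spin (f : TorusSite 4 L × Fin 3 × Fin 4 → ℝ) :
    ∑ q, f q = ∑ z : TorusSite 4 L, ∑ b : Fin 3, ∑ β : Fin 4, f (z, b, β) := by
  rw [Fintype.sum_prod_type]
  refine Finset.sum_congr rfl fun z _ => ?_
  rw [Fintype.sum_prod_type]

/-- **Weighted `ℓ²` sums from an entry profile**: if `‖g(z,b,β)‖ ≤ C φ(z)` for all `z, b, β`
and the site weight `w` is nonnegative, then `Σ_q w(q.1) ‖g q‖² ≤ 12 C² Σ_z w(z) φ(z)²`. -/
theorem sum_weight_norm_sq_le_of_profile (g : TorusSite 4 L × Fin 3 × Fin 4 → ℂ) (w φ : TorusSite 4 L → ℝ)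
    {C : ℝ} (hw : ∀ z, 0 ≤ w z) (hg : ∀ z b β, ‖g (z, b, β)‖ ≤ C * φ z) :
    ∑ q, w q.1 * ‖g q‖ ^ 2 ≤ 12 * C ^ 2 * ∑ z, w z * φ z ^ 2 := by
  rw [sum_site_colour_spin (fun q => w q.1 * ‖g q‖ ^ 2), Finset.mul_sum]
  refine Finset.sum_le_sum fun z _ => ?_
  have hterm : ∀ b β, w z * ‖g (z, b, β)‖ ^ 2 ≤ w z * (C * φ z) ^ 2 := fun b β =>
    mul_le_mul_of_nonneg_left (pow_le_pow_left₀ (norm_nonneg _) (hg z b β) 2) (hw z)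
  calc ∑ b : Fin 3, ∑ β : Fin 4, w z * ‖g (z, b, β)‖ ^ 2
      ≤ ∑ _b : Fin 3, ∑ _β : Fin 4, w z * (C * φ z) ^ 2 :=
        Finset.sum_le_sum fun b _ => Finset.sum_le_sum fun β _ => hterm b β
    _ = 12 * C ^ 2 * (w z * φ z ^ 2) := by simp; ring

/-- **Weighted `ℓ¹` sums from an entry profile**: under the same hypotheses,
`Σ_q w(q.1) ‖g q‖ ≤ 12 C Σ_z w(z) φ(z)`. -/
theorem sum_weight_norm_le_of_profile (g : TorusSite 4 L × Fin 3 × Fin 4 → ℂ) (w φ : TorusSite 4 L → ℝ)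
    {C : ℝ} (hw : ∀ z, 0 ≤ w z) (hg : ∀ z b β, ‖g (z, b, β)‖ ≤ C * φ z) :
    ∑ q, w q.1 * ‖g q‖ ≤ 12 * C * ∑ z, w z * φ z := by
  rw [sum_site_colour_spin (fun q => w q.1 * ‖g q‖), Finset.mul_sum]
  refine Finset.sum_le_sum fun z _ => ?_
  have hterm : ∀ b β, w z * ‖g (z, b, β)‖ ≤ w z * (C * φ z) := fun b β =>
    mul_le_mul_of_nonneg_left (hg z b β) (hw z)
  calc ∑ b : Fin 3, ∑ β : Fin 4, w z * ‖g (z, b, β)‖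
      ≤ ∑ _b : Fin 3, ∑ _β : Fin 4, w z * (C * φ z) :=
        Finset.sum_le_sum fun b _ => Finset.sum_le_sum fun β _ => hterm b β
    _ = 12 * C * (w z * φ z) := by simp; ring

end Weighted

/-! ### Time integrals of the merged smoothing profile -/

/-- `∫₀ᵇ du/√(1 + k u) ≤ 2√(1 + k b)/k` for `k > 0`, `b ≥ 0` (fundamental theorem of calculus for
`u ↦ (2/k)√(1 + k u)`). -/
theorem integral_inv_sqrt_one_add_mul_le {k b : ℝ} (hk : 0 < k) (hb : 0 ≤ b) :
    ∫ u in (0:ℝ)..b, 1 / Real.sqrt (1 + k * u) ≤ 2 * Real.sqrt (1 + k * b) / k := by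
  have hderiv : ∀ u ∈ Set.uIcc (0:ℝ) b,
      HasDerivAt (fun u => 2 / k * Real.sqrt (1 + k * u)) (1 / Real.sqrt (1 + k * u)) u := by
    intro u hu
    rw [Set.uIcc_of_le hb] at hu
    have hpos : 0 < 1 + k * u := by nlinarith [hu.1]
    have h1 : HasDerivAt (fun u : ℝ => 1 + k * u) k u := by
      simpa using ((hasDerivAt_id' u).const_mul k).const_add 1
    have h2 := (h1.sqrt hpos.ne').const_mul (2 / k)
    refine h2.congr_deriv ?_
    have : Real.sqrt (1 + k * u) ≠ 0 := (Real.sqrt_pos.mpr hpos).ne'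
    field_simp
  have hcont : ContinuousOn (fun u : ℝ => 1 / Real.sqrt (1 + k * u)) (Set.uIcc 0 b) := by
    rw [Set.uIcc_of_le hb]
    refine ContinuousOn.div continuousOn_const (by fun_prop) fun u hu => ?_
    exact (Real.sqrt_pos.mpr (by nlinarith [hu.1])).ne'
  rw [integral_eq_sub_of_hasDerivAt hderiv (hcont.intervalIntegrable)]
  simp only [mul_zero, add_zero, Real.sqrt_one, mul_one]
  have h2k : 0 ≤ 2 / k := by positivity
  have : 2 / k * Real.sqrt (1 + k * b) = 2 * Real.sqrt (1 + k * b) / k := by ring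
  rw [← this]
  linarith

/-- **Late-interval constant**: for `s ≥ 0`,
`(9√2/√(1 + s/2)) · (2√(1 + 162e·(s/2))/(162e)) ≤ 2` — the merged smoothing profile integrated over the late
half `[s/2, s]` of the Duhamel integral against the free column's `(1+τ)^{-1/2} ≤ (1+s/2)^{-1/2}` is `s`-uniform
(`1 + 81 e s ≤ 162 e (1 + s/2)` because `162 e ≥ 1`, and `18/(9√e) ≤ 2`). -/
theorem late_smoothing_const_le {s : ℝ} (hs : 0 ≤ s) :
    9 * Real.sqrt 2 / Real.sqrt (1 + s / 2) *
        (2 * Real.sqrt (1 + 162 * Real.exp 1 * (s / 2)) / (162 * Real.exp 1)) ≤ 2 := by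
  have he1 : 1 ≤ Real.exp 1 := Real.one_le_exp one_pos.le
  have he : 0 < Real.exp 1 := Real.exp_pos 1
  have hA : 0 < 1 + s / 2 := by positivity
  have hsA : 0 < Real.sqrt (1 + s / 2) := Real.sqrt_pos.mpr hA
  -- `√(1 + 81 e s) ≤ √(162 e) · √(1 + s/2)`
  have hkey : Real.sqrt (1 + 162 * Real.exp 1 * (s / 2)) ≤ Real.sqrt (162 * Real.exp 1) * Real.sqrt (1 + s / 2) := by
    rw [← Real.sqrt_mul (by positivity)]
    exact Real.sqrt_le_sqrt (by nlinarith)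
  -- `√(162 e) = 9 √2 √e`
  have h162 : Real.sqrt (162 * Real.exp 1) = 9 * Real.sqrt 2 * Real.sqrt (Real.exp 1) := by
    rw [show (162 : ℝ) * Real.exp 1 = 9 ^ 2 * (2 * Real.exp 1) by ring, Real.sqrt_mul (by norm_num),
      Real.sqrt_sq (by norm_num), Real.sqrt_mul (by norm_num), mul_assoc]
  have hsqe : Real.sqrt (Real.exp 1) * Real.sqrt (Real.exp 1) = Real.exp 1 := Real.mul_self_sqrt he.le
  have hs2 : Real.sqrt 2 * Real.sqrt 2 = 2 := Real.mul_self_sqrt (by norm_num)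
  have hsqe1 : 1 ≤ Real.sqrt (Real.exp 1) := Real.one_le_sqrt.mpr he1
  -- reduce to a statement about `X := √(1+162e(s/2))`
  rw [div_mul_div_comm, div_le_iff₀ (by positivity)]
  calc 9 * Real.sqrt 2 * (2 * Real.sqrt (1 + 162 * Real.exp 1 * (s / 2)))
      ≤ 9 * Real.sqrt 2 * (2 * (Real.sqrt (162 * Real.exp 1) * Real.sqrt (1 + s / 2))) := by
        gcongr
    _ = 2 * (81 * 2 * Real.sqrt (Real.exp 1)) * Real.sqrt (1 + s / 2) := by
        rw [h162]
        have h22 : Real.sqrt 2 ^ 2 = 2 := Real.sq_sqrt (by norm_num)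
        linear_combination (162 * Real.sqrt (Real.exp 1) * Real.sqrt (1 + s / 2)) * h22
    _ ≤ 2 * (Real.sqrt (1 + s / 2) * (162 * Real.exp 1)) := by
        have : 81 * 2 * Real.sqrt (Real.exp 1) ≤ 162 * Real.exp 1 := by nlinarith [hsqe, hsqe1]
        nlinarith [hsA]

/-- **Early-interval constant**: for `s ≥ 2`, `(√2/√(e s)) · (2√(1 + s/2)) ≤ 2√2` — the smoothed vertex on the
early half `[0, s/2]` (`σ = s − τ ≥ s/2`, smoothing factor `≤ (e s)^{-1/2}`) integrated against `(1+τ)^{-1/2}`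
is `s`-uniform (`1 + s/2 ≤ s ≤ e s` for `s ≥ 2`). -/
theorem early_smoothing_const_le {s : ℝ} (hs : 2 ≤ s) :
    Real.sqrt 2 / Real.sqrt (Real.exp 1 * s) * (2 * Real.sqrt (1 + s / 2)) ≤ 2 * Real.sqrt 2 := by
  have he1 : 1 ≤ Real.exp 1 := Real.one_le_exp one_pos.le
  have hes : 0 < Real.exp 1 * s := by positivity
  have hsq : Real.sqrt (1 + s / 2) ≤ Real.sqrt (Real.exp 1 * s) := Real.sqrt_le_sqrt (by nlinarith)
  have hpos : 0 < Real.sqrt (Real.exp 1 * s) := Real.sqrt_pos.mpr hes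
  rw [div_mul_eq_mul_div, div_le_iff₀ hpos]
  nlinarith [Real.sqrt_nonneg 2, Real.sqrt_nonneg (1 + s / 2)]


/-! ### From pointwise bounds of the Duhamel integrand to the column bound -/

open Summit.QuantumFields.QCD.Cruxes.SmallFieldUltracontractivity.PointCentredAxialParabolic in
/-- **Minkowski bookkeeping for the column Duhamel.**  Let `v_q = ∫₀ˢ F(τ)_q dτ` with `F(·)_q` continuous on `[0,s]`,
and suppose the `ℓ²` norm of `F(τ)` is bounded (i) for all `τ ∈ [0,s]` by
`φ(s−τ)·P/√(1+τ) + P/(1+τ)` and (ii), when `s ≥ 2`, for `τ ∈ [0,s/2]` by `φ(s−τ)·P/√(1+τ) + Q/s`, where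
`φ(σ) = 9√2/√(1+162eσ)` is the merged smoothing profile and `P, Q ≥ 0`.  Then `‖v‖₂ ≤ 40 P + Q`.
(For `s < 2` use (i) with constants; for `s ≥ 2` split at `s/2`: (ii) on the early half with
`∫₀^{s/2} dτ/√(1+τ) ≤ 2√(1+s/2)` and `early_smoothing_const_le`, (i) on the late half with
`integral_inv_sqrt_one_add_mul_le` and `late_smoothing_const_le`.) -/
theorem column_norm_le_of_pointwise {ι : Type} [Fintype ι] (v : ι → ℂ) (F : ℝ → ι → ℂ) {s P Q : ℝ}
    (hs0 : 0 ≤ s) (hP : 0 ≤ P) (hQ : 0 ≤ Q)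
    (hduh : ∀ q, v q = ∫ τ in (0:ℝ)..s, F τ q)
    (hFcont : ∀ q, ContinuousOn (fun τ => F τ q) (Set.Icc 0 s))
    (hpt1 : ∀ τ, 0 ≤ τ → τ ≤ s → Real.sqrt (∑ q, ‖F τ q‖ ^ 2) ≤
      9 * Real.sqrt 2 / Real.sqrt (1 + 162 * Real.exp 1 * (s - τ)) * (P / Real.sqrt (1 + τ)) + P / (1 + τ))
    (hpt2 : 2 ≤ s → ∀ τ, 0 ≤ τ → τ ≤ s / 2 → Real.sqrt (∑ q, ‖F τ q‖ ^ 2) ≤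
      9 * Real.sqrt 2 / Real.sqrt (1 + 162 * Real.exp 1 * (s - τ)) * (P / Real.sqrt (1 + τ)) + Q / s) :
    Real.sqrt (∑ q, ‖v q‖ ^ 2) ≤ 40 * P + Q := by
  have hFint : ∀ q (a' b' : ℝ), 0 ≤ a' → a' ≤ b' → b' ≤ s → IntervalIntegrable (fun τ => F τ q) volume a' b' := by
    intro q a' b' ha hab hb
    exact ((hFcont q).mono (Set.uIcc_subset_Icc ⟨ha, hab.trans hb⟩ ⟨ha.trans hab, hb⟩)).intervalIntegrable
  have hφle : ∀ σ, 0 ≤ σ → 9 * Real.sqrt 2 / Real.sqrt (1 + 162 * Real.exp 1 * σ) ≤ 9 * Real.sqrt 2 := fun σ hσ => by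
    refine div_le_self (by positivity) ?_
    exact Real.one_le_sqrt.mpr (by nlinarith [Real.exp_pos 1])
  have hsqrt2 : Real.sqrt 2 ≤ 2 := by
    rw [show (2:ℝ) = Real.sqrt 4 by rw [show (4:ℝ) = 2 ^ 2 by norm_num, Real.sqrt_sq (by norm_num)]]
    exact Real.sqrt_le_sqrt (by norm_num)
  by_cases hs2 : s < 2
  · -- small times: one interval, constant dominating function
    set G : ℝ → ℝ := fun _ => 9 * Real.sqrt 2 * P + P with hG
    have hbound : ∀ τ ∈ Set.Icc (0:ℝ) s, Real.sqrt (∑ q, ‖F τ q‖ ^ 2) ≤ G τ := by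
      intro τ hτ
      refine (hpt1 τ hτ.1 hτ.2).trans (add_le_add ?_ ?_)
      · have h1 : P / Real.sqrt (1 + τ) ≤ P := div_le_self hP (Real.one_le_sqrt.mpr (by linarith [hτ.1]))
        calc 9 * Real.sqrt 2 / Real.sqrt (1 + 162 * Real.exp 1 * (s - τ)) * (P / Real.sqrt (1 + τ))
            ≤ 9 * Real.sqrt 2 * P := mul_le_mul (hφle _ (by linarith [hτ.2])) h1 (by positivity) (by positivity)
          _ = _ := rfl
      · exact div_le_self hP (by linarith [hτ.1])
    have hdual := sqrt_sum_norm_sq_le_integral_of_forall_le v F G hs0 hFcont continuousOn_const hduh hbound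
    refine hdual.trans ?_
    rw [intervalIntegral.integral_const, smul_eq_mul, sub_zero]
    have hX : 0 ≤ 9 * Real.sqrt 2 * P + P := by positivity
    calc s * (9 * Real.sqrt 2 * P + P) ≤ 2 * (9 * Real.sqrt 2 * P + P) := mul_le_mul_of_nonneg_right hs2.le hX
      _ ≤ 40 * P + Q := by nlinarith [hsqrt2, hP, hQ, Real.sqrt_nonneg 2]
  · -- large times: split at `s/2`
    push Not at hs2
    have hs4 : 0 ≤ s / 2 := by linarith
    have hsplit : ∀ q, v q = (∫ τ in (0:ℝ)..(s / 2), F τ q) + ∫ τ in (s / 2)..s, F τ q := fun q => by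
      rw [hduh q, intervalIntegral.integral_add_adjacent_intervals (hFint q 0 (s / 2) le_rfl hs4 (by linarith))
        (hFint q (s / 2) s hs4 (by linarith) le_rfl)]
    -- early half
    set Ge : ℝ → ℝ := fun τ => Real.sqrt 2 / Real.sqrt (Real.exp 1 * s) * P * (1 / Real.sqrt (1 + τ)) + Q / s with hGe
    have hGe_cont : ContinuousOn Ge (Set.Icc 0 (s / 2)) := by
      rw [hGe]
      refine ContinuousOn.add (ContinuousOn.mul continuousOn_const ?_) continuousOn_const
      refine ContinuousOn.div continuousOn_const (by fun_prop) fun τ hτ => ?_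
      exact (Real.sqrt_pos.mpr (by linarith [hτ.1])).ne'
    have hφ_early : ∀ τ ∈ Set.Icc (0:ℝ) (s / 2),
        9 * Real.sqrt 2 / Real.sqrt (1 + 162 * Real.exp 1 * (s - τ)) ≤ Real.sqrt 2 / Real.sqrt (Real.exp 1 * s) := by
      intro τ hτ
      have hes : 0 < Real.exp 1 * s := by positivity
      have h81 : Real.sqrt (81 * (Real.exp 1 * s)) ≤ Real.sqrt (1 + 162 * Real.exp 1 * (s - τ)) :=
        Real.sqrt_le_sqrt (by nlinarith [hτ.2, Real.exp_pos 1])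
      rw [Real.sqrt_mul (by norm_num), show (81:ℝ) = 9 ^ 2 by norm_num, Real.sqrt_sq (by norm_num)] at h81
      rw [div_le_div_iff₀ (Real.sqrt_pos.mpr (by nlinarith [hτ.2, Real.exp_pos 1])) (Real.sqrt_pos.mpr hes)]
      nlinarith [Real.sqrt_nonneg 2, Real.sqrt_nonneg (Real.exp 1 * s)]
    have hbound_e : ∀ τ ∈ Set.Icc (0:ℝ) (s / 2), Real.sqrt (∑ q, ‖F τ q‖ ^ 2) ≤ Ge τ := by
      intro τ hτ
      refine (hpt2 hs2 τ hτ.1 hτ.2).trans ?_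
      rw [hGe]
      refine add_le_add ?_ le_rfl
      have hq : 0 ≤ P / Real.sqrt (1 + τ) := by positivity
      calc 9 * Real.sqrt 2 / Real.sqrt (1 + 162 * Real.exp 1 * (s - τ)) * (P / Real.sqrt (1 + τ))
          ≤ (Real.sqrt 2 / Real.sqrt (Real.exp 1 * s)) * (P / Real.sqrt (1 + τ)) :=
            mul_le_mul_of_nonneg_right (hφ_early τ hτ) hq
        _ = Real.sqrt 2 / Real.sqrt (Real.exp 1 * s) * P * (1 / Real.sqrt (1 + τ)) := by ring
    have hdual_e := sqrt_sum_norm_sq_le_integral_of_forall_le (fun q => ∫ τ in (0:ℝ)..(s / 2), F τ q) F Ge hs4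
      (fun q => (hFcont q).mono (Set.Icc_subset_Icc le_rfl (by linarith))) hGe_cont (fun q => rfl) hbound_e
    have hint_e : (∫ τ in (0:ℝ)..(s / 2), Ge τ) ≤ 2 * Real.sqrt 2 * P + Q / 2 := by
      rw [hGe, intervalIntegral.integral_add, intervalIntegral.integral_const_mul, intervalIntegral.integral_const,
        smul_eq_mul, sub_zero]
      · refine add_le_add ?_ (le_of_eq (by field_simp))
        have hI := integral_inv_sqrt_one_add_le hs4
        calc Real.sqrt 2 / Real.sqrt (Real.exp 1 * s) * P * ∫ τ in (0:ℝ)..(s / 2), 1 / Real.sqrt (1 + τ)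
            ≤ Real.sqrt 2 / Real.sqrt (Real.exp 1 * s) * P * (2 * Real.sqrt (1 + s / 2)) :=
              mul_le_mul_of_nonneg_left hI (by positivity)
          _ = (Real.sqrt 2 / Real.sqrt (Real.exp 1 * s) * (2 * Real.sqrt (1 + s / 2))) * P := by ring
          _ ≤ 2 * Real.sqrt 2 * P := mul_le_mul_of_nonneg_right (early_smoothing_const_le hs2) hP
      · refine ContinuousOn.intervalIntegrable ?_
        rw [Set.uIcc_of_le hs4]
        refine ContinuousOn.mul continuousOn_const ?_
        refine ContinuousOn.div continuousOn_const (by fun_prop) fun τ hτ => ?_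
        exact (Real.sqrt_pos.mpr (by linarith [hτ.1])).ne'
      · exact intervalIntegrable_const
    -- late half
    set Gl : ℝ → ℝ := fun τ => P / Real.sqrt (1 + s / 2) * (9 * Real.sqrt 2) *
        (1 / Real.sqrt (1 + 162 * Real.exp 1 * (s - τ))) + P / (1 + s / 2) with hGl
    have hGl_cont : ContinuousOn Gl (Set.Icc (s / 2) s) := by
      rw [hGl]
      refine ContinuousOn.add (ContinuousOn.mul continuousOn_const ?_) continuousOn_const
      refine ContinuousOn.div continuousOn_const (by fun_prop) fun τ hτ => ?_
      exact (Real.sqrt_pos.mpr (by nlinarith [hτ.2, Real.exp_pos 1])).ne'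
    have hbound_l : ∀ τ ∈ Set.Icc (s / 2) s, Real.sqrt (∑ q, ‖F τ q‖ ^ 2) ≤ Gl τ := by
      intro τ hτ
      have hτ0 : 0 ≤ τ := by linarith [hτ.1]
      refine (hpt1 τ hτ0 hτ.2).trans ?_
      rw [hGl]
      refine add_le_add ?_ ?_
      · have h1 : P / Real.sqrt (1 + τ) ≤ P / Real.sqrt (1 + s / 2) :=
          div_le_div_of_nonneg_left hP (Real.sqrt_pos.mpr (by linarith)) (Real.sqrt_le_sqrt (by linarith [hτ.1]))
        have h2 : 0 ≤ 9 * Real.sqrt 2 / Real.sqrt (1 + 162 * Real.exp 1 * (s - τ)) := by positivity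
        calc 9 * Real.sqrt 2 / Real.sqrt (1 + 162 * Real.exp 1 * (s - τ)) * (P / Real.sqrt (1 + τ))
            ≤ 9 * Real.sqrt 2 / Real.sqrt (1 + 162 * Real.exp 1 * (s - τ)) * (P / Real.sqrt (1 + s / 2)) :=
              mul_le_mul_of_nonneg_left h1 h2
          _ = _ := by ring
      · exact div_le_div_of_nonneg_left hP (by linarith) (by linarith [hτ.1])
    have hdual_l := sqrt_sum_norm_sq_le_integral_of_forall_le (fun q => ∫ τ in (s / 2)..s, F τ q) F Gl
      (by linarith : s / 2 ≤ s) (fun q => (hFcont q).mono (Set.Icc_subset_Icc hs4 le_rfl)) hGl_cont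
      (fun q => rfl) hbound_l
    have hint_l : (∫ τ in (s / 2)..s, Gl τ) ≤ 2 * P + P := by
      rw [hGl, intervalIntegral.integral_add, intervalIntegral.integral_const_mul, intervalIntegral.integral_const,
        smul_eq_mul]
      · refine add_le_add ?_ ?_
        · have hsub : (∫ τ in (s / 2)..s, 1 / Real.sqrt (1 + 162 * Real.exp 1 * (s - τ))) =
              ∫ u in (0:ℝ)..(s / 2), 1 / Real.sqrt (1 + 162 * Real.exp 1 * u) := by
            rw [intervalIntegral.integral_comp_sub_left (fun u => 1 / Real.sqrt (1 + 162 * Real.exp 1 * u)) s]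
            congr 1 <;> ring
          rw [hsub]
          have hI := integral_inv_sqrt_one_add_mul_le (k := 162 * Real.exp 1) (by positivity) hs4
          calc P / Real.sqrt (1 + s / 2) * (9 * Real.sqrt 2) *
                ∫ u in (0:ℝ)..(s / 2), 1 / Real.sqrt (1 + 162 * Real.exp 1 * u)
              ≤ P / Real.sqrt (1 + s / 2) * (9 * Real.sqrt 2) *
                  (2 * Real.sqrt (1 + 162 * Real.exp 1 * (s / 2)) / (162 * Real.exp 1)) :=
                mul_le_mul_of_nonneg_left hI (by positivity)
            _ = (9 * Real.sqrt 2 / Real.sqrt (1 + s / 2) *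
                  (2 * Real.sqrt (1 + 162 * Real.exp 1 * (s / 2)) / (162 * Real.exp 1))) * P := by ring
            _ ≤ 2 * P := mul_le_mul_of_nonneg_right (late_smoothing_const_le hs0) hP
        · have h1 : (s - s / 2) * (P / (1 + s / 2)) = (s / 2) / (1 + s / 2) * P := by ring
          rw [h1]
          refine mul_le_of_le_one_left hP ?_
          rw [div_le_one (by linarith)]; linarith
      · refine ContinuousOn.intervalIntegrable ?_
        rw [Set.uIcc_of_le (by linarith : s / 2 ≤ s)]
        refine ContinuousOn.mul continuousOn_const ?_
        refine ContinuousOn.div continuousOn_const (by fun_prop) fun τ hτ => ?_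
        exact (Real.sqrt_pos.mpr (by nlinarith [hτ.2, Real.exp_pos 1])).ne'
      · exact intervalIntegrable_const
    -- combine
    have hsum : Real.sqrt (∑ q, ‖v q‖ ^ 2) ≤
        Real.sqrt (∑ q, ‖∫ τ in (0:ℝ)..(s / 2), F τ q‖ ^ 2) + Real.sqrt (∑ q, ‖∫ τ in (s / 2)..s, F τ q‖ ^ 2) := by
      simp only [hsplit]
      exact sqrt_sum_norm_sq_add_le _ _
    refine hsum.trans ((add_le_add (hdual_e.trans hint_e) (hdual_l.trans hint_l)).trans ?_)
    nlinarith [hsqrt2, hP, hQ, Real.sqrt_nonneg 2]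


/-- **Registered form (stub `stub_columnNormOfPointwise` of the crux item)**: the Minkowski bookkeeping
`column_norm_le_of_pointwise` at an explicit finite index type. -/
theorem stub_columnNormOfPointwise :
    ∀ (ι : Type) [Fintype ι] (v : ι → ℂ) (F : ℝ → ι → ℂ) (s P Q : ℝ), 0 ≤ s → 0 ≤ P → 0 ≤ Q →
      (∀ q, v q = ∫ τ in (0:ℝ)..s, F τ q) → (∀ q, ContinuousOn (fun τ => F τ q) (Set.Icc 0 s)) →
      (∀ τ, 0 ≤ τ → τ ≤ s → Real.sqrt (∑ q, ‖F τ q‖ ^ 2) ≤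
        9 * Real.sqrt 2 / Real.sqrt (1 + 162 * Real.exp 1 * (s - τ)) * (P / Real.sqrt (1 + τ)) + P / (1 + τ)) →
      (2 ≤ s → ∀ τ, 0 ≤ τ → τ ≤ s / 2 → Real.sqrt (∑ q, ‖F τ q‖ ^ 2) ≤
        9 * Real.sqrt 2 / Real.sqrt (1 + 162 * Real.exp 1 * (s - τ)) * (P / Real.sqrt (1 + τ)) + Q / s) →
      Real.sqrt (∑ q, ‖v q‖ ^ 2) ≤ 40 * P + Q :=
  fun _ _ v F _ _ _ hs hP hQ hduh hc h1 h2 => column_norm_le_of_pointwise v F hs hP hQ hduh hc h1 h2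

end Summit.QuantumFields.QCD.Cruxes.InterleavedHeatSliceFlow.Sketch

end
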